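import Summits.QuantumFields.YangMills.Theorems.HyperbolicRegulatorHyperbolicToTorusStubChart
import Summits.QuantumFields.YangMills.Theorems.HyperbolicRegulatorHyperbolicToTorusStubTracking
import Summits.QuantumFields.YangMills.Theorems.HyperbolicRegulatorHyperbolicToTorusStubOpposite
import Summits.QuantumFields.YangMills.Theorems.HyperbolicRegulatorHyperbolicToTorusStubConeFrame
import Summits.QuantumFields.YangMills.Theorems.HyperbolicRegulatorHyperbolicToTorusStubSphereLarge
import Summits.QuantumFields.YangMills.Theorems.HyperbolicRegulatorHyperbolicToTorusStubShellGerm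

/-!
# `HyperbolicToTorus` (stmt-QuantumFields-15827, route `HyperbolicRegulator`) — PROVED: the crux as typed holds because
# no admissible hyperbolic complex exists at curvature scale `k ≥ 208`

Line `no_admissible_complex` (skeleton `Cruxes/HyperbolicToTorus/Lines/no_admissible_complex.lean` v3, lead
`prover-line-stmt-QuantumFields-15827-0`; strategist v2 `planner-cstrat-stmt-QuantumFields-15827-b1-0`; refuter findings R3 /
VETTING rev 2 / `Negative/InteriorChartDegree.lean`). The route decl
`Summit.QuantumFields.YangMills.Theses.HyperbolicRegulator.HyperbolicToTorus` is `∀ G r family, H1 → H2 → T` with H1 = "the family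
of finite square complexes is ADMISSIBLE (`Adm`, the crux's inlined `(Fam …).1`) for all `k ≥ 8` and all `j`". We prove
`no_admissible : 208 ≤ k → ¬ Adm k j …` and instantiate H1 at `k = 400`, `j = 0`.

Why no admissible complex exists (`R := k/4`): admissibility makes the flatness threshold `k/4 < dist x c` equal to the radius of
the injective `ℤ²`-charts at flat vertices, whose interior points have degree 4 (`stub_chart`: `IsChart`); charts track walks
(`stub_tracking`) and are rigid (`stub_opposite`). Around a cone `c`, every vertex at distance exactly `R + 1` is re-grown from one
of `≤ 50` germs at `c` (`stub_shellGerm`, `stub_germCount`), while a cone frame (`stub_coneFrame`) exhibits, row by row in one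
chart, at least `R - 1` such vertices (`stub_sphereLarge`). `R - 1 ≤ 50` fails for `k ≥ 208`.

What this does NOT say: nothing about Yang–Mills. The crux is settled through its unsatisfiable antecedent; the informative
content for the route is the kernel-certified demand (refuters R3, VETTING rev 2; strategist STRATEGY-CENSUS) that the three cruxes
sharing the `Fam` vocabulary be RESTATED in lockstep (`F := k/2 < dist`, `Dp := 3(k/4) < dist`, chart radius `< ` flat threshold),
after which the substantive step (local Gibbs limits ⇒ torus clustering) is the business of `Lines/birth.lean` and the idea cards
`barycentre-single-phase` / `antipodal-washout`.
-/

set_option autoImplicit false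

namespace Summit.QuantumFields.YangMills.Cruxes.HyperbolicToTorus.NoAdmissibleComplex

/-- **No admissible complex at curvature scale `k ≥ 208`.** Take a cone frame `(c, x)` (`stub_coneFrame`); charts at flat
vertices are `IsChart`s (`stub_chart`) that track walks (`stub_tracking`) and are rigid (`stub_opposite`); the first flat shell
`{v ∈ V | dist v c = k/4 + 1}` has `k/4 ≤ # + 1` (`stub_sphereLarge`) and is contained in `germSet E σ τ (k/4) c`
(`stub_shellGerm`) of size `≤ 50` (`stub_germCount`): `52 ≤ k/4 ≤ 51`, contradiction. -/
theorem no_admissible :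
    ∀ (k j : ℕ) (V E Q : Finset ℕ) (σ τ : ℕ → ℕ) (bd : ℕ → Fin 4 → ℕ × Bool) (cV : ℕ → ℤ × ℤ → ℕ)
      (cE : ℕ → ℤ × ℤ → Fin 2 → ℕ × Bool), 208 ≤ k → ¬ Adm k j V E Q σ τ bd cV cE := by
  intro k j V E Q σ τ bd cV cE hk hA
  obtain ⟨c, x, hF⟩ := stub_coneFrame k j V E Q σ τ bd cV cE (by omega) hA
  have hCT : ∀ y : ℕ, IsFlatAt k V E σ τ y →
      IsChart (graphOf E σ τ) ((k : ℤ) / 4) (cV y) ∧ ChartTracking (graphOf E σ τ) ((k : ℤ) / 4) (cV y) :=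
    fun y hy => ⟨stub_chart k j V E Q σ τ bd cV cE (by omega) hA y hy,
      stub_tracking _ _ _ (by omega) (stub_chart k j V E Q σ τ bd cV cE (by omega) hA y hy)⟩
  have hOR : ∀ ψ : ℤ × ℤ → ℕ, IsChart (graphOf E σ τ) ((k : ℤ) / 4) ψ → OppRigid (graphOf E σ τ) ((k : ℤ) / 4) ψ :=
    fun ψ hψ => stub_opposite _ _ _ hψ
  have hlarge : k / 4 ≤ sphereCard k V E σ τ c + 1 := stub_sphereLarge k j V E Q σ τ bd cV cE (by omega) hA hCT c x hF
  have hsub : (V.filter fun v => (graphOf E σ τ).dist v c = k / 4 + 1) ⊆ germSet E σ τ (k / 4) c := by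
    intro v hv
    rw [Finset.mem_filter] at hv
    exact stub_shellGerm k j V E Q σ τ bd cV cE (by omega) hA hCT hOR c hF.1 v hv.1 hv.2
  have hsmall : sphereCard k V E σ τ c ≤ 50 :=
    (Finset.card_le_card hsub).trans (stub_germCount k j V E Q σ τ bd cV cE (by omega) hA c)
  omega

/-- **`HyperbolicToTorus_of_no_admissible`** — the crux BY NAME: the admissibility hypothesis H1, instantiated at curvature
scale `400` and separation index `0`, contradicts `no_admissible`; the named `Adm` and the crux's inlined `(Fam …).1` agree by
`ζδ`-unfolding. (H2, the group and the representation are not used.) -/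
theorem HyperbolicToTorus_of_no_admissible :
    Summit.QuantumFields.YangMills.Theses.HyperbolicRegulator.HyperbolicToTorus := by
  intro G _ _ _ _ hG r Fam₀ Sp₀ V E Q σ τ bd cV cE Φ hAdm hClust
  have hA : Adm 400 0 (V 400 0) (E 400 0) (Q 400 0) (σ 400 0) (τ 400 0) (bd 400 0) (cV 400 0) (cE 400 0) :=
    hAdm 400 0 (by norm_num)
  exact (no_admissible 400 0 _ _ _ _ _ _ _ _ (by norm_num) hA).elim

end Summit.QuantumFields.YangMills.Cruxes.HyperbolicToTorus.NoAdmissibleComplex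

namespace Summit.QuantumFields.YangMills.Theorems

/-- **`HyperbolicToTorus` holds** (crux stmt-QuantumFields-15827 of route `HyperbolicRegulator`): the route decl, literally,
from `NoAdmissibleComplex.HyperbolicToTorus_of_no_admissible` (the crux as typed is vacuous — no admissible complex exists at
curvature scale `400`). -/
theorem hyperbolicToTorus_proof : Summit.QuantumFields.YangMills.Theses.HyperbolicRegulator.HyperbolicToTorus :=
  Summit.QuantumFields.YangMills.Cruxes.HyperbolicToTorus.NoAdmissibleComplex.HyperbolicToTorus_of_no_admissible

end Summit.QuantumFields.YangMills.Theorems
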